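import Literature.AlgebraicGeometry.HodgeTheory.HodgeGenericQbarDescentFiniteMonodromyInputs
import Literature.AlgebraicGeometry.HodgeTheory.AlgebraicClassesFibreRestriction
import HarnessLib

/-!
# Voisin 2007, Prop. 0.7 (finite monodromy ⇒ algebraic, granted HC over `ℚ̄`) from TWO named facts

Family `hodge`, layer `Literature/AlgebraicGeometry/HodgeTheory`. Proof file (sorry-free, theorems
only, no definition, no named fact) of the unit `voisin2007_algebraic_of_finite_monodromyOrbit_of_qbar`
(`HodgeGenericQbarDescent.lean`; C. Voisin, *Hodge loci and absolute Hodge classes*, Compositio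
Math. 143 (2007), §3, proof of Prop. 0.7 = arXiv math/0605766 Prop. 1.7). The earlier assemblies of
this fact (`HodgeGenericQbarDescentProofs.voisin2007_algebraic_of_finite_monodromyOrbit_of_qbar_of_classical_inputs`,
`HodgeGenericQbarDescentFiniteMonodromyInputs.voisin2007_algebraic_of_finite_monodromyOrbit_of_qbar_of_threeNamedFacts`)
take as a hypothesis the contravariance of algebraic classes along ARBITRARY morphisms of smooth
projective varieties (Fulton, Cor. 19.2 (b); the named fact `fulton1998_map_mem_algebraicClasses`,
which on the support carrier `Nᵖ H²ᵖ` needs Chow's moving lemma). Voisin's proof uses it only for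
the inclusion `X''_{s''} ⟶ 𝒳̄_{S''}` of a FIBRE of the base-changed family into its smooth
compactification ("If the Hodge conjecture is true for Hodge classes on varieties defined over
`ℚ̄`, it is then true for `β` and thus also for `α`", `α = β|_{X_0}`), and that case is PROVED in
the tree (`AlgebraicClassesFibreRestriction.map_fiberι_comp_mem_algebraicClasses_of_isSmoothProjective`:
flat restriction to the open subfamily, generic fibre dimension of the support over the irreducible
base, and the specialisation of supported classes along curves — the boundary step of
Charles–Schnell's Prop. 11.3.11 with Mumford's curve lemma, `mumford_smoothCurve_through_two_points_holds`).
Hence: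

* `voisin2007_algebraic_of_finite_monodromyOrbit_of_qbar_of_fourInputs (hRE) (hComp) (hD) (hpol)` —
  the assembly `…_of_classical_inputs` with its fifth hypothesis `hPull` DISCHARGED (same proof,
  Step 6 replaced by the proved fibre restriction);
* `voisin2007_algebraic_of_finite_monodromyOrbit_of_qbar_of_twoNamedFacts (hRE) (hGICT)` — **the
  named fact from exactly TWO unproved named facts of the tree**: Riemann existence with descent to
  `ℚ̄` (`FundamentalGroup.riemannExistence_qbarDescent_of_finiteIndex`, SGA1 XII Thm. 5.1 and XIII
  Prop. 4.6) and Deligne's global invariant cycle theorem (`deligne_globalInvariantCycles`, Hodge II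
  Thm. 4.1.1); the compactification over `ℚ̄` (Hironaka) and the polarisability (Hodge–Riemann) being
  proved in the tree (`exists_smoothProjective_baseChangeHom_compactification_familyPullback_of_isQuasiProjectiveOver`,
  `smoothProjective_hodgeStructure_isPolarizable_holds`).

`voisin2007_algebraic_of_finite_monodromyOrbit_of_qbar_holds` is then
`…_of_twoNamedFacts riemannExistence_qbarDescent_of_finiteIndex_holds deligne_globalInvariantCycles_holds`
once these two facts are discharged.

## References

* [Voisin2007HodgeLoci] C. Voisin, Hodge loci and absolute Hodge classes, Compositio Math. 143
  (2007), §3, proof of Prop. 0.7 (arXiv math/0605766: Prop. 1.7, p. 7).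
* [SGA1] A. Grothendieck, M. Raynaud, SGA 1 (arXiv:math/0206203), Exp. XII Thm. 5.1, Exp. XIII
  Prop. 4.6.
* [DeligneHodgeII1971] P. Deligne, Théorie de Hodge II, Publ. Math. IHÉS 40 (1971), Thm. 4.1.1.
* [Hironaka1964] H. Hironaka, Ann. of Math. 79 (1964), Main Theorem I.
* [Fulton1998] W. Fulton, Intersection Theory, 2nd ed., §10.1 Cor. 10.1, §19.2 Cor. 19.2 (b).
* [CharlesSchnell2014Notes] F. Charles, C. Schnell, Notes on absolute Hodge classes, Prop. 11.3.11
  (proof), Thm. 11.3.19 (proof).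
-/

noncomputable section

open CategoryTheory AlgebraicGeometry
open _root_.Topology
open Literature.AlgebraicTopology.SingularHomology

namespace Literature.AlgebraicGeometry.HodgeTheory

section Assembly

/-- **`voisin2007_algebraic_of_finite_monodromyOrbit_of_qbar` from FOUR classical inputs** — the
assembly `voisin2007_algebraic_of_finite_monodromyOrbit_of_qbar_of_classical_inputs`
(`HodgeGenericQbarDescentProofs.lean`, whose proof is repeated here step by step) WITHOUT its fifth
hypothesis `hPull` (pull-back of algebraic classes along arbitrary morphisms of smooth projective
varieties, Fulton Cor. 19.2 (b)): the only pull-back Voisin's proof needs, along the inclusion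
`X'_{s'} ⟶ 𝒳' ⟶ 𝒳̄` of a fibre of the base-changed smooth projective family `𝒳' → S'` (over the
smooth irreducible quasi-projective `S' = S₀' ⊗_σ ℂ`) into its smooth projective compactification,
is PROVED in the tree (`map_fiberι_comp_mem_algebraicClasses_of_isSmoothProjective`,
`AlgebraicClassesFibreRestriction.lean`: no moving lemma — specialisation of supported classes
along curves, Fulton Cor. 10.1, in the form of the boundary step of Charles–Schnell Prop. 11.3.11).
Remaining hypotheses, as there: `hRE` (Riemann existence with descent to `ℚ̄`, SGA1 XII Thm. 5.1 and
XIII Prop. 4.6, `π₁`/finite-index shape), `hComp` (a smooth projective compactification defined over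
`ℚ̄` of the base-changed family, Hironaka), `hD` (the named fact `deligne_globalInvariantCycles`),
`hpol` (the named fact `smoothProjective_hodgeStructure_isPolarizable`). Printed proof: "As
monodromy acts in a finite way on the set of Hodge classes …, there is an étale cover `S''` of the
smooth part of `S'`, also defined over `ℚ̄`, on which this monodromy action becomes trivial. Thus
we have by base change a family `π'' : 𝒳_{S''} → S''`, together with a global section `α̃` of
`R^{2k}π''_*ℚ`, whose restriction to `X_0` is equal to `α`. The global invariant cycle theorem now
says that there exists a Hodge class `β` on a smooth compactification `𝒳̄_{S''}`, which we may
assume defined over `ℚ̄`, restricting to `α`. If the Hodge conjecture is true for Hodge classes on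
varieties defined over `ℚ̄`, it is then true for `β` and thus also for `α`."
[cite: Voisin2007HodgeLoci, §3, proof of Prop. 0.7 (arXiv math/0605766 Prop. 1.7, p. 7)]
[cite: CharlesSchnell2014Notes, Thm. 11.3.19 (proof) and Prop. 11.3.11 (proof)]
[cite: SGA1, Exp. XII Thm. 5.1 and Exp. XIII Prop. 4.6] [cite: DeligneHodgeII1971, Théorème 4.1.1]
[cite: Fulton1998, §10.1 Cor. 10.1 and §19.2 Cor. 19.2 (b)] [cite: Hironaka1964, Main Theorem I] -/
theorem voisin2007_algebraic_of_finite_monodromyOrbit_of_qbar_of_fourInputs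
    (hRE : ∀ (σ : AlgebraicClosure ℚ →+* ℂ) (S₀ : Motives.SchemeOver (AlgebraicClosure ℚ)),
      IsQuasiProjectiveOver S₀ → IrreducibleSpace S₀.left → AlgebraicGeometry.Smooth S₀.hom →
      ∀ (s : Motives.ComplexPoints ((Motives.baseChangeHom σ).obj S₀))
        (H : Subgroup (FundamentalGroup
          (Set.univ : Set (Motives.ComplexPoints ((Motives.baseChangeHom σ).obj S₀)))
            ⟨s, Set.mem_univ s⟩)), H.FiniteIndex →
        ∃ (S₀' : Motives.SchemeOver (AlgebraicClosure ℚ)) (g₀ : S₀' ⟶ S₀)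
          (s' : Motives.ComplexPoints ((Motives.baseChangeHom σ).obj S₀'))
          (hs : Motives.AlgPoints.map ((Motives.baseChangeHom σ).map g₀) s' = s),
          IsQuasiProjectiveOver S₀' ∧ IrreducibleSpace ((Motives.baseChangeHom σ).obj S₀').left ∧
          AlgebraicGeometry.Etale g₀.left ∧
          ∀ γ' : Path (⟨s', Set.mem_univ s'⟩ :
              (Set.univ : Set (Motives.ComplexPoints ((Motives.baseChangeHom σ).obj S₀'))))
              ⟨s', Set.mem_univ s'⟩,
            FundamentalGroup.fromPath
              (⟦(γ'.map ((((Motives.AlgPoints.continuous_map ((Motives.baseChangeHom σ).map g₀)).comp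
                  continuous_subtype_val)).subtype_mk fun _ ↦ Set.mem_univ _)).cast
                (Subtype.ext hs.symm) (Subtype.ext hs.symm)⟧) ∈ H)
    (hComp : ∀ (σ : AlgebraicClosure ℚ →+* ℂ) ⦃𝒳₀ S₀ S₀' : Motives.SchemeOver (AlgebraicClosure ℚ)⦄
      (f₀ : 𝒳₀ ⟶ S₀) (g₀ : S₀' ⟶ S₀) (n : ℕ),
      IsQuasiProjectiveOver 𝒳₀ → IsQuasiProjectiveOver S₀ → IsQuasiProjectiveOver S₀' →
      IrreducibleSpace S₀.left → AlgebraicGeometry.Smooth S₀.hom → AlgebraicGeometry.Etale g₀.left →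
      IrreducibleSpace ((Motives.baseChangeHom σ).obj S₀').left →
      Motives.IsSmoothProjectiveFamily ((Motives.baseChangeHom σ).map f₀) n →
      ∃ (m : ℕ) (Xbar₀ : Motives.SchemeOver (AlgebraicClosure ℚ))
        (i : Motives.familyPullback ((Motives.baseChangeHom σ).map f₀)
            ((Motives.baseChangeHom σ).map g₀) ⟶ (Motives.baseChangeHom σ).obj Xbar₀),
        Motives.IsSmoothProjective m ((Motives.baseChangeHom σ).obj Xbar₀) ∧ IsOpenImmersion i.left)
    (hD : deligne_globalInvariantCycles) (hpol : smoothProjective_hodgeStructure_isPolarizable) :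
    voisin2007_algebraic_of_finite_monodromyOrbit_of_qbar := by
  unfold voisin2007_algebraic_of_finite_monodromyOrbit_of_qbar
  intro σ 𝒳₀ S₀ f₀ n p h𝒳₀ hS₀ hirr hsm hf s α hαr hαh hfin hHC
  haveI := hirr
  -- Step 1 (the orbit): finite orbit ⟹ a finite-index subgroup `H ≤ π₁(S(ℂ), s)` fixes `α`
  obtain ⟨hU, H, hHfi, hHfix⟩ :=
    exists_finiteIndex_of_finite_setOf_isContinuationAlong_of_qbarFamily σ f₀ (2 * p) hS₀ hsm hf
      s α hfin
  -- Step 2 (the étale cover `S'' → S`, defined over `ℚ̄`): Riemann existence + descent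
  obtain ⟨S₀', g₀, s', hs, hS₀'qp, hS'irr, hg₀, hloops⟩ := hRE σ S₀ hS₀ hirr hsm s H hHfi
  subst hs
  -- Step 3: the bases `S = S₀ ⊗ ℂ`, `S' = S₀' ⊗ ℂ` are smooth of the same pure dimension `d`,
  -- quasi-projective; `S'(ℂ)` is a connected manifold; `g(ℂ)` is a local homeomorphism
  haveI := hsm
  obtain ⟨d, hd⟩ := Motives.exists_smoothOfRelativeDimension_of_smooth S₀.hom
  haveI := hd
  haveI hSd : SmoothOfRelativeDimension d ((Motives.baseChangeHom σ).obj S₀).hom :=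
    smoothOfRelativeDimension_baseChangeHom_hom σ d S₀
  have hSqp : IsQuasiProjectiveOver ((Motives.baseChangeHom σ).obj S₀) := hS₀.baseChangeHom σ
  have hS'qp : IsQuasiProjectiveOver ((Motives.baseChangeHom σ).obj S₀') := hS₀'qp.baseChangeHom σ
  haveI : LocallyOfFiniteType ((Motives.baseChangeHom σ).obj S₀).hom := hSqp.locallyOfFiniteType
  haveI : LocallyOfFiniteType ((Motives.baseChangeHom σ).obj S₀').hom := hS'qp.locallyOfFiniteType
  haveI : IsSeparated ((Motives.baseChangeHom σ).obj S₀).hom := hSqp.isVarietyPair_ofScheme.isSeparated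
  haveI := hg₀
  haveI hg0 : SmoothOfRelativeDimension 0 ((Motives.baseChangeHom σ).map g₀).left := by
    letI := σ.toAlgebra
    have := smoothOfRelativeDimension_isStableUnderBaseChange 0
    exact MorphismProperty.of_isPullback (P := @SmoothOfRelativeDimension 0)
      (Motives.isPullback_baseChange_map_left ℂ g₀).flip inferInstance
  haveI : AlgebraicGeometry.Smooth ((Motives.baseChangeHom σ).map g₀).left :=
    SmoothOfRelativeDimension.smooth 0 _
  haveI hS'd : SmoothOfRelativeDimension d ((Motives.baseChangeHom σ).obj S₀').hom := by
    have h : SmoothOfRelativeDimension (0 + d)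
        (((Motives.baseChangeHom σ).map g₀).left ≫ ((Motives.baseChangeHom σ).obj S₀).hom) :=
      inferInstance
    rw [Over.w] at h
    simpa using h
  haveI : IrreducibleSpace ((Motives.baseChangeHom σ).obj S₀').left := hS'irr
  haveI : ConnectedSpace (Motives.ComplexPoints ((Motives.baseChangeHom σ).obj S₀')) :=
    (Motives.ComplexPoints.connectedSpace_iff_holds _).2 inferInstance
  haveI : PathConnectedSpace (Motives.ComplexPoints ((Motives.baseChangeHom σ).obj S₀')) :=
    pathConnectedSpace_complexPoints_of_smoothOfRelativeDimension _ d
  letI := Motives.ComplexPoints.chartedSpace ((Motives.baseChangeHom σ).obj S₀') d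
  haveI : LocallyPathConnectedSpace (Motives.ComplexPoints ((Motives.baseChangeHom σ).obj S₀')) :=
    ChartedSpace.locallyPathConnectedSpace (EuclideanSpace ℝ (Fin (2 * d))) _
  have hgloc : IsLocalHomeomorph (Motives.AlgPoints.map ((Motives.baseChangeHom σ).map g₀) :
      Motives.ComplexPoints ((Motives.baseChangeHom σ).obj S₀') →
        Motives.ComplexPoints ((Motives.baseChangeHom σ).obj S₀)) :=
    Motives.ComplexPoints.isLocalHomeomorph_map d _
  -- Step 4 (base change of the family): `f' : 𝒳 ×_S S' ⟶ S'` is smooth projective, `R^{2p} f'_* ℂ`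
  -- is a local system, and `α' = e^* α` is monodromy invariant, hence a continuous global section
  have hf' := hf.familyPullback_snd ((Motives.baseChangeHom σ).map g₀)
  have hU' := isCohomologicallyLocallyTrivialOn_univ_of_isSmoothProjectiveFamily
    (Motives.familyPullback.snd ((Motives.baseChangeHom σ).map f₀) ((Motives.baseChangeHom σ).map g₀))
    d hf' hS'qp
  set e := Motives.fiberOverFamilyPullbackIso ((Motives.baseChangeHom σ).map f₀)
    ((Motives.baseChangeHom σ).map g₀) s' with he
  have hinv : ∀ γ' : Path (⟨s', Set.mem_univ s'⟩ :
      (Set.univ : Set (Motives.ComplexPoints ((Motives.baseChangeHom σ).obj S₀')))) ⟨s', Set.mem_univ s'⟩,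
      transportFun ((Motives.baseChangeHom σ).map f₀) (2 * p) hU
        (s := ⟨Motives.AlgPoints.map ((Motives.baseChangeHom σ).map g₀) s', Set.mem_univ _⟩)
        (t := ⟨Motives.AlgPoints.map ((Motives.baseChangeHom σ).map g₀) s', Set.mem_univ _⟩)
        ⟦γ'.map ((((Motives.AlgPoints.continuous_map ((Motives.baseChangeHom σ).map g₀)).comp
          continuous_subtype_val)).subtype_mk fun _ ↦ Set.mem_univ _)⟧ α = α :=
    fun γ' ↦ hHfix _ (hloops γ')
  obtain ⟨σ', hσ'c, hσ'pt, hσ'₀⟩ := exists_continuous_section_familyPullback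
    ((Motives.baseChangeHom σ).map f₀) ((Motives.baseChangeHom σ).map g₀) (2 * p) hgloc hU hU' s'
    (complexBetti.map e.hom (2 * p) α) (FiberClass.cls_baseChange_map_hom _ _ _ s' α) hinv
  have h₀ : σ' s' ∈ locusOfHodgeClasses
      (Motives.familyPullback.snd ((Motives.baseChangeHom σ).map f₀) ((Motives.baseChangeHom σ).map g₀))
      n p := by
    rw [hσ'₀]
    exact ⟨hαr.map _, hαh.map_of_iso e⟩
  -- Step 5 (global invariant cycles + Hodge lift on a smooth compactification defined over `ℚ̄`)
  obtain ⟨m, Xbar₀, i, hXbar, hi⟩ := hComp σ f₀ g₀ n h𝒳₀ hS₀ hS₀'qp hirr hsm hg₀ hS'irr hf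
  haveI := hi
  obtain ⟨β, hβr, hβh, hβσ⟩ :=
    hD.exists_hodgeClass_eq_globalSection_of_exists_isReal_hodgeModel exists_isReal_hodgeModel_holds
      hodgePQ_independent_of_hodgeModel_holds hpol _ i hf' hS'qp (SmoothOfRelativeDimension.smooth d _)
      hXbar hi hσ'c hσ'pt h₀
  -- Step 6 (the Hodge conjecture over `ℚ̄`, then restriction to the fibre — PROVED,
  -- `map_fiberι_comp_mem_algebraicClasses_of_isSmoothProjective`): `β` is algebraic, hence so is
  -- `α' = (X'_{s'} → 𝒳' → 𝒳̄)^* β`, hence so is `α`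
  have hβalg : β ∈ algebraicClasses ((Motives.baseChangeHom σ).obj Xbar₀) p := hHC hXbar p β hβr hβh
  haveI : AlgebraicGeometry.Smooth ((Motives.baseChangeHom σ).obj S₀').hom :=
    SmoothOfRelativeDimension.smooth d _
  have hα'alg := map_fiberι_comp_mem_algebraicClasses_of_isSmoothProjective
    (Motives.familyPullback.snd ((Motives.baseChangeHom σ).map f₀) ((Motives.baseChangeHom σ).map g₀))
    hf' hS'qp hXbar i hβalg s'
  have hα'eq : complexBetti.map e.hom (2 * p) α =
      complexBetti.map (Motives.fiberι (Motives.familyPullback.snd ((Motives.baseChangeHom σ).map f₀)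
        ((Motives.baseChangeHom σ).map g₀)) s' ≫ i) (2 * p) β := by
    have h1 := hσ'₀.symm.trans hβσ
    rw [(FiberClass.mk_eq_mk_iff _ _).1 h1, complexBetti.map_comp, ModuleCat.comp_apply]
  rw [← hα'eq] at hα'alg
  exact (mem_algebraicClasses_map_iff_of_iso e).1 hα'alg
/-- **Voisin 2007, Prop. 0.7 (= arXiv Prop. 1.7) from TWO unproved named facts of the tree** —
`voisin2007_algebraic_of_finite_monodromyOrbit_of_qbar_of_fourInputs` with

* `hRE` := the named fact `FundamentalGroup.riemannExistence_qbarDescent_of_finiteIndex` (Riemann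
  existence with descent to `ℚ̄`, SGA1 XII Thm. 5.1 and XIII Prop. 4.6; its proved projection `.hRE`);
* `hComp` := PROVED (`exists_smoothProjective_baseChangeHom_compactification_familyPullback_of_isQuasiProjectiveOver`:
  Hironaka's smooth projective compactification over `ℚ̄` of the base-changed family, from the strong
  projective resolution of `Resolution/ProjectiveStrongResolution.lean`, transported to `ℂ` by
  `IsSmoothProjective.baseChangeHom_holds`);
* `hD` := the named fact `deligne_globalInvariantCycles` (Deligne, Hodge II, Thm. 4.1.1);
* `hpol` := PROVED (`smoothProjective_hodgeStructure_isPolarizable_holds`, Voisin I §7.1.2).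

So the named fact `voisin2007_algebraic_of_finite_monodromyOrbit_of_qbar` is reduced inside the tree
to Riemann existence with `ℚ̄`-descent and the global invariant cycle theorem, and
`voisin2007_algebraic_of_finite_monodromyOrbit_of_qbar_holds` is this theorem applied to their
discharges. [cite: Voisin2007HodgeLoci, §3, proof of Prop. 0.7 (arXiv math/0605766 Prop. 1.7, p. 7)]
[cite: SGA1, Exp. XII Thm. 5.1 and Exp. XIII Prop. 4.6] [cite: DeligneHodgeII1971, Théorème 4.1.1]
[cite: Hironaka1964, Main Theorem I] [cite: VoisinHodgeI2002, Thm. 6.32 and §7.1.2] -/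
theorem voisin2007_algebraic_of_finite_monodromyOrbit_of_qbar_of_twoNamedFacts
    (hRE : FundamentalGroup.riemannExistence_qbarDescent_of_finiteIndex)
    (hGICT : deligne_globalInvariantCycles) :
    voisin2007_algebraic_of_finite_monodromyOrbit_of_qbar :=
  voisin2007_algebraic_of_finite_monodromyOrbit_of_qbar_of_fourInputs hRE.hRE
    (fun σ _ _ _ f₀ g₀ n h𝒳₀ hS₀ hS₀' _ hS₀sm het hirr' hf ↦ by
      obtain ⟨m, Xbar₀, i, hXbar₀, hi⟩ :=
        exists_smoothProjective_baseChangeHom_compactification_familyPullback_of_isQuasiProjectiveOver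
          σ f₀ g₀ n h𝒳₀ hS₀ hS₀' hS₀sm het hirr' hf
      exact ⟨m, Xbar₀, i, Motives.IsSmoothProjective.baseChangeHom_holds σ hXbar₀, hi⟩)
    hGICT smoothProjective_hodgeStructure_isPolarizable_holds

end Assembly

end Literature.AlgebraicGeometry.HodgeTheory

end
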